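import Summits.BirchSwinnertonDyer.BirchSwinnertonDyer.Theorems.ErratumRoadFiveNonSurjCornerNewformClassTraceTest
import Summits.BirchSwinnertonDyer.BirchSwinnertonDyer.Theorems.ErratumRoadFiveNonSurjCornerFrobeniusOrdersSeven
import HarnessLib

/-!
# Route `ErratumRoadFive` (K2), crux `NonSurjCorner` (19065) ∕ child `NonSurjCornerTwinMuAn` (19948):
# THE `p ≥ 7` TRACE TEST READ ON THE NEWFORM — a weight-2 newform class `(f, ι)` with one coefficient `ι(a_ℓ(f)) = t`, `t ∈ 𝔽_p`, `t ≠ 0` and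
# `t² − 4ℓ` a NON-square in `𝔽_p`, hosts no corner pair at `p`
# (cell `bsd-stepL`, WIDTH-LEVER lane B `bsd-stepL-corner5-p2` g10; `--supports stmt-BirchSwinnertonDyer-19948 --as helper`)

WHY. Companion of `…NewformClassTraceTest` (`p = 5`) for the `p ≥ 7` branch of the corner, whose image is the full normaliser of a split Cartan subgroup
(lane B g2; trace test p630580: `p ∣ a_ℓ(E)` or `a_ℓ(E)² − 4ℓ` is a square mod `p`). Read on a newform class `(f, ιf)` to which the curve's framed mod-`p`
representation is attached off `S` (`IsGaloisRepOfNewform1Int`, the Serre-level door's currency): the `X`-coefficient `P₁` of the integral Hecke lift at a good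
prime `ℓ ∉ S`, `ℓ ≠ p`, satisfies `ιf(P₁) = −a_ℓ(E)` in `𝔽̄_p` (p634211), so whenever `ιf(P₁)` is the image of some `t ∈ 𝔽_p` (the class is `𝔽_p`-rational at `ℓ`),
`t = 0` or `t² − 4ℓ` is a square in `𝔽_p`. This is the sieve of lane B's Serre-level census at `p = 7`.

HONEST FRAMING: structure theorem; no named fact used or added; nothing proves the crux, a stub or BSD for any class; closes: none (T7).
[cite: Serre1972, §2.2, §2.7 Prop. 17] [cite: DeligneSerreASENS1974, Thm. 6.1] [cite: Zywina2015, Thm. 1.5]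
-/

set_option linter.dupNamespace false -- `Summit.BirchSwinnertonDyer.BirchSwinnertonDyer` (summit = problem), tree-wide

noncomputable section

open scoped Classical MatrixGroups ModularForm NumberField

namespace Summit.BirchSwinnertonDyer.BirchSwinnertonDyer.Theorems.CornerShape

open CongruenceSubgroup WeierstrassCurve Literature.NumberTheory.EllipticCurves
  Literature.NumberTheory.EllipticCurves.ModularForms
  Literature.NumberTheory.EllipticCurves.Rank1Residual
  Literature.NumberTheory.GaloisRepresentations Literature.NumberTheory.Automorphic
  Literature.NumberTheory.Automorphic.BCDT
  IsDedekindDomain IsDedekindDomain.HeightOneSpectrum Rat.HeightOneSpectrum NumberField Polynomial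
  Summit.BirchSwinnertonDyer.Rank1Residual

/-- **THE TRACE TEST ON THE NEWFORM CLASS (`p ≥ 7`).** `E/ℚ` globally minimal, `p ≥ 7` multiplicative, `E[p]` irreducible, `ρ̄_{E,p}` not onto, its framed mod-`p`
representation attached to `(f, ιf)` off `S`; `ℓ ∉ S`, `ℓ ≠ p`, a prime of good reduction; `P` an integral lift of the Hecke polynomial of `f` at `ℓ`. If `ιf(P₁)` is
the image of `t ∈ 𝔽_p`, then `t = 0` or `t² − 4ℓ` is a square in `𝔽_p` (`t = −a_ℓ(E) mod p` by `map_coeff_one_heckeLift_eq_neg_frobeniusTrace`, then the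
curve-side test `dvd_frobeniusTrace_or_isSquare_discr`). [cite: Serre1972, §2.2] [cite: DeligneSerreASENS1974, Thm. 6.1] -/
theorem NonSurjCorner.newformClass_traceTest_of_seven_le
    (W : WeierstrassCurve ℚ) [W.IsElliptic] [W.IsGloballyMinimal] (p : ℕ) [Fact p.Prime] (hp7 : 7 ≤ p)
    (hmult : Mult W p) (hirr : Irr W p) (hns : ¬ Surj W p)
    [TopologicalSpace (AlgebraicClosure (ZMod p))] [DiscreteTopology (AlgebraicClosure (ZMod p))]
    {ρ : ModPGaloisRep ℚ (ZMod p) 2} (hρ : W.IsTorsionGaloisRep p ρ)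
    {M : ℕ} [NeZero M] {f : CuspForm (Gamma1 M) 2} (ιf : coeffCharIntegers f →+* AlgebraicClosure (ZMod p)) (S : Set ℕ)
    (h : IsGaloisRepOfNewform1Int f ιf S
      (FramedRep.baseChange (algebraMap (ZMod p) (AlgebraicClosure (ZMod p))) continuous_of_discreteTopology ρ))
    (ℓ : ℕ) [Fact ℓ.Prime] (hℓS : ℓ ∉ S) (hℓp : ℓ ≠ p) (hg : W.HasGoodReductionAtPrime ℓ)
    (P : Polynomial (coeffCharIntegers f)) (hP : P.map (algebraMap (coeffCharIntegers f) (coeffCharField f)) = heckePolynomial f ℓ)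
    (t : ZMod p) (ht : ιf (P.coeff 1) = algebraMap (ZMod p) (AlgebraicClosure (ZMod p)) t) :
    t = 0 ∨ IsSquare (t ^ 2 - 4 * (ℓ : ZMod p)) := by
  have hco := map_coeff_one_heckeLift_eq_neg_frobeniusTrace W p hρ ιf S h ℓ hℓS hℓp hg P hP
  -- `t = −a_ℓ(E)` in `𝔽_p`
  have htr : t = -(W.frobeniusTrace ℓ : ZMod p) := by
    apply (algebraMap (ZMod p) (AlgebraicClosure (ZMod p))).injective
    rw [← ht, hco, map_neg]
  rcases NonSurjCorner.dvd_frobeniusTrace_or_isSquare_discr W p hp7 hmult hirr hns ℓ hℓp hg with hdvd | hsq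
  · left
    rw [htr, neg_eq_zero]
    exact (ZMod.intCast_zmod_eq_zero_iff_dvd _ p).mpr hdvd
  · right
    have : ((W.frobeniusTrace ℓ ^ 2 - 4 * ℓ : ℤ) : ZMod p) = t ^ 2 - 4 * (ℓ : ZMod p) := by
      rw [htr]; push_cast; ring
    rw [← this]; exact hsq

/-- **Instance for 19948's ∕ 19065's populations at `7`** (`Mult ∧ Irr` from `ClassX11a`∕`ClassX11b`, `ρ̄` not onto): the class-side test at `p = 7`.
[cite: Serre1972, §2.2] [cite: Zywina2015, Thm. 1.5] -/
theorem NonSurjCorner.newformClass_traceTest_seven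
    (W : WeierstrassCurve ℚ) [W.IsElliptic] [W.IsGloballyMinimal] [Fact (Nat.Prime 7)]
    (hmult : Mult W 7) (hirr : Irr W 7) (hns : ¬ Surj W 7)
    [TopologicalSpace (AlgebraicClosure (ZMod 7))] [DiscreteTopology (AlgebraicClosure (ZMod 7))]
    {ρ : ModPGaloisRep ℚ (ZMod 7) 2} (hρ : W.IsTorsionGaloisRep 7 ρ)
    {M : ℕ} [NeZero M] {f : CuspForm (Gamma1 M) 2} (ιf : coeffCharIntegers f →+* AlgebraicClosure (ZMod 7)) (S : Set ℕ)
    (h : IsGaloisRepOfNewform1Int f ιf S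
      (FramedRep.baseChange (algebraMap (ZMod 7) (AlgebraicClosure (ZMod 7))) continuous_of_discreteTopology ρ))
    (ℓ : ℕ) [Fact ℓ.Prime] (hℓS : ℓ ∉ S) (hℓ7 : ℓ ≠ 7) (hg : W.HasGoodReductionAtPrime ℓ)
    (P : Polynomial (coeffCharIntegers f)) (hP : P.map (algebraMap (coeffCharIntegers f) (coeffCharField f)) = heckePolynomial f ℓ)
    (t : ZMod 7) (ht : ιf (P.coeff 1) = algebraMap (ZMod 7) (AlgebraicClosure (ZMod 7)) t) :
    t = 0 ∨ IsSquare (t ^ 2 - 4 * (ℓ : ZMod 7)) :=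
  NonSurjCorner.newformClass_traceTest_of_seven_le W 7 le_rfl hmult hirr hns hρ ιf S h ℓ hℓS hℓ7 hg P hP t ht

end Summit.BirchSwinnertonDyer.BirchSwinnertonDyer.Theorems.CornerShape

end
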